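import Mathlib

/-!
# Route BarrierLever — Chow witnesses for partition minors (item 20172, CPM): determinant algebra of
# the GENERAL `m`-EDGE STEP (a row coordinate with `m` edges against a column coordinate with `m` edges)

Helper file (`--supports stmt-ValiantsHypothesis-20172`; cell valiant-natproofs, rung V4, 𝒟-side of
door (c); seat val-np-p4 gen 14).  Closes NO item; pure matrix algebra, the `m`-fold generalisation of
`…ChowEdgeStep` (`m = 1`) and `…ChowTwoEdgeStepDet` (`m = 2`, `det_twoMasked_ne_zero`,
`det_twoEdgeMatrix_eq`, `exists_det_twoEdge_ne_zero`), written ONCE for all `m` in block (`Sum`)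
indexing so that no `succAbove` bookkeeping is needed: the index type is `Fin m ⊕ ρ`, the `m` TOP rows /
columns are `Sum.inl l`, everything else (including the `m` BASE rows `βr l` and base columns `βc l`)
is `Sum.inr _`.  A consumer re-indexes a `Fin (r + m)` layout along an equivalence
`Fin (r + m) ≃ Fin m ⊕ Fin r` (as `…ChowTwoEdgeStepDet` does with `exists_equivPairCompl`).

**The statement (`exists_det_multiEdge_ne_zero`).**  Let `F` be a square matrix over `ℂ` indexed by
`Fin m ⊕ ρ`, `P` (resp. `Q`) a predicate on row (resp. column) indices — in the application
`P i = (a ∈ u i)`, `Q j = (c ∈ w j)` — with `P (inl l)`, `¬ P (inr (βr l))`, `Q (inl l)`,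
`¬ Q (inr (βc l))`, and suppose each top row equals its base row and each top column its base column
(`F (inl l) j = F (inr (βr l)) j`, `F i (inl l) = F i (inr (βc l))` — the coefficient matrix of the
`a, c`-erased layout under a common witness does not see `x_a`, `y_c`).  If the `m × m` BASE MINOR
`[F (inr (βr l)) (inr (βc l'))]` and the REDUCED minor `F.submatrix inr inr` are both nonsingular, then
for some `t : ℂ` the masked matrix `M(t) i j = t^{[P i][Q j]} · F i j` is nonsingular.  (With the
one-parameter edge gadget `(1 + x_a + (1 − t) y_c)(1 + t y_c)` the partition matrix of «gadget × lifted
common witness» is exactly `M(t)`, `coeff_partitionExpo_mul_pairFactor`; so this is the algebraic heart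
of the `m`-edge step: EDGE-COUNT profiles of rows and columns of a minimal unhit layout share no value.)

Proof: subtracting base rows from top rows is left multiplication by a unipotent block matrix, and
leaves `(t − 1)·[Q j]·F (βr l) j` in the top rows, so `det M(t) = (t − 1)^m · D(t)` with `D(t)` the
determinant of the matrix `N(t)` whose top rows are the `Q`-masked base rows; at `t = 1`, subtracting
base columns from top columns (right multiplication by a unipotent block matrix) makes `N(1)` block
upper-triangular with diagonal blocks the base minor and the reduced minor, so `D(1) ≠ 0`; `D` is
continuous, hence nonzero at some `t ≠ 1`.

WHAT THIS IS NOT: the layout-level step (lift + gadget + common witness) is the consumer's job, as in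
`…ChowTwoEdgeStep`; nothing on items 20172 / 20195 / 19717 themselves, on crux
stmt-ValiantsHypothesis-14610, or on `VP` versus `VNP`.
-/

set_option linter.dupNamespace false

namespace Summit.ValiantsHypothesis.ValiantsHypothesis.Theorems.BarrierLever.ChowFactor

open Matrix

noncomputable section

variable {m : ℕ} {ρ : Type*} [Fintype ρ] [DecidableEq ρ]

/-- The masked matrix of the `m`-edge step: `M(t) i j = (t if P i ∧ Q j, else 1) · F i j`. -/
def multiEdgeMatrix (F : Matrix (Fin m ⊕ ρ) (Fin m ⊕ ρ) ℂ) (P Q : Fin m ⊕ ρ → Prop)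
    [DecidablePred P] [DecidablePred Q] (t : ℂ) : Matrix (Fin m ⊕ ρ) (Fin m ⊕ ρ) ℂ :=
  Matrix.of fun i j => (if P i ∧ Q j then t else 1) * F i j

/-- The auxiliary matrix `N(t)`: top rows replaced by the `Q`-masked base rows, the other rows those of
`M(t)`. -/
def multiEdgeAux (F : Matrix (Fin m ⊕ ρ) (Fin m ⊕ ρ) ℂ) (P Q : Fin m ⊕ ρ → Prop)
    [DecidablePred P] [DecidablePred Q] (βr : Fin m → ρ) (t : ℂ) : Matrix (Fin m ⊕ ρ) (Fin m ⊕ ρ) ℂ :=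
  Matrix.of fun i j => match i with
    | Sum.inl l => (if Q j then (1 : ℂ) else 0) * F (Sum.inr (βr l)) j
    | Sum.inr k => (if P (Sum.inr k) ∧ Q j then t else 1) * F (Sum.inr k) j

/-- **Row reduction**: `det M(t) = (t − 1)^m · det N(t)` when top rows equal base rows, `P` holds on top
rows and fails on base rows. -/
theorem det_multiEdgeMatrix_eq (F : Matrix (Fin m ⊕ ρ) (Fin m ⊕ ρ) ℂ) (P Q : Fin m ⊕ ρ → Prop)
    [DecidablePred P] [DecidablePred Q] (βr : Fin m → ρ) (hP : ∀ l, P (Sum.inl l))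
    (hP0 : ∀ l, ¬ P (Sum.inr (βr l))) (hrow : ∀ l j, F (Sum.inl l) j = F (Sum.inr (βr l)) j) (t : ℂ) :
    (multiEdgeMatrix F P Q t).det = (t - 1) ^ m * (multiEdgeAux F P Q βr t).det := by
  classical
  -- E = unipotent: subtract base rows from top rows
  set E : Matrix (Fin m ⊕ ρ) (Fin m ⊕ ρ) ℂ :=
    Matrix.fromBlocks 1 (Matrix.of fun l k => if k = βr l then (-1 : ℂ) else 0) 0 1 with hE
  have hEdet : E.det = 1 := by
    rw [hE, Matrix.det_fromBlocks_zero₂₁, Matrix.det_one, Matrix.det_one, mul_one]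
  -- Δ = diag (t-1 on top rows, 1 elsewhere)
  set Δ : Matrix (Fin m ⊕ ρ) (Fin m ⊕ ρ) ℂ := Matrix.diagonal (Sum.elim (fun _ => t - 1) (fun _ => 1))
    with hΔ
  have hΔdet : Δ.det = (t - 1) ^ m := by
    rw [hΔ, Matrix.det_diagonal, Fintype.prod_sum_type]
    simp
  have hEM_inl : ∀ l j, (E * multiEdgeMatrix F P Q t) (Sum.inl l) j =
      multiEdgeMatrix F P Q t (Sum.inl l) j - multiEdgeMatrix F P Q t (Sum.inr (βr l)) j := by
    intro l j
    rw [Matrix.mul_apply, Fintype.sum_sum_type]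
    simp [hE, Matrix.one_apply, ite_mul, Finset.sum_ite_eq, sub_eq_add_neg]
  have hEM_inr : ∀ k j, (E * multiEdgeMatrix F P Q t) (Sum.inr k) j = multiEdgeMatrix F P Q t (Sum.inr k) j := by
    intro k j
    rw [Matrix.mul_apply, Fintype.sum_sum_type]
    simp [hE, Matrix.one_apply, ite_mul, Finset.sum_ite_eq]
  have hΔN : ∀ i j, (Δ * multiEdgeAux F P Q βr t) i j =
      Sum.elim (fun _ => t - 1) (fun _ => (1 : ℂ)) i * multiEdgeAux F P Q βr t i j := by
    intro i j
    rw [hΔ, Matrix.diagonal_mul]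
  have key : E * multiEdgeMatrix F P Q t = Δ * multiEdgeAux F P Q βr t := by
    ext i j
    rcases i with l | k
    · rw [hEM_inl, hΔN, Sum.elim_inl]
      simp only [multiEdgeMatrix, multiEdgeAux, Matrix.of_apply, hrow l j, hP l, hP0 l, true_and,
        false_and, if_false, one_mul]
      split_ifs <;> ring
    · rw [hEM_inr, hΔN, Sum.elim_inr, one_mul]
      simp only [multiEdgeMatrix, multiEdgeAux, Matrix.of_apply]
  have h1 := congrArg Matrix.det key
  rw [Matrix.det_mul, Matrix.det_mul, hEdet, one_mul, hΔdet] at h1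
  exact h1

/-- **Column reduction at `t = 1`**: `det N(1) = ± det(base minor) · det(reduced minor)`, precisely
`det N(1) = det K · det (F.submatrix inr inr)` with `K l l' = F (inr (βr l)) (inr (βc l'))`. -/
theorem det_multiEdgeAux_one (F : Matrix (Fin m ⊕ ρ) (Fin m ⊕ ρ) ℂ) (P Q : Fin m ⊕ ρ → Prop)
    [DecidablePred P] [DecidablePred Q] (βr βc : Fin m → ρ) (hQ : ∀ l, Q (Sum.inl l))
    (hQ0 : ∀ l, ¬ Q (Sum.inr (βc l))) (hcol : ∀ i l, F i (Sum.inl l) = F i (Sum.inr (βc l))) :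
    (multiEdgeAux F P Q βr 1).det =
      (Matrix.of fun l l' : Fin m => F (Sum.inr (βr l)) (Sum.inr (βc l'))).det *
        (F.submatrix Sum.inr Sum.inr).det := by
  classical
  set H : Matrix (Fin m ⊕ ρ) (Fin m ⊕ ρ) ℂ :=
    Matrix.fromBlocks 1 0 (Matrix.of fun k l => if k = βc l then (-1 : ℂ) else 0) 1 with hH
  have hHdet : H.det = 1 := by
    rw [hH, Matrix.det_fromBlocks_zero₁₂, Matrix.det_one, Matrix.det_one, mul_one]
  have hNH_inl : ∀ i l', (multiEdgeAux F P Q βr 1 * H) i (Sum.inl l') =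
      multiEdgeAux F P Q βr 1 i (Sum.inl l') - multiEdgeAux F P Q βr 1 i (Sum.inr (βc l')) := by
    intro i l'
    rw [Matrix.mul_apply, Fintype.sum_sum_type]
    simp [hH, Matrix.one_apply, mul_ite, Finset.sum_ite_eq', sub_eq_add_neg]
  have hNH_inr : ∀ i k', (multiEdgeAux F P Q βr 1 * H) i (Sum.inr k') = multiEdgeAux F P Q βr 1 i (Sum.inr k') := by
    intro i k'
    rw [Matrix.mul_apply, Fintype.sum_sum_type]
    simp [hH, Matrix.one_apply, mul_ite, Finset.sum_ite_eq']
  have key : multiEdgeAux F P Q βr 1 * H = Matrix.fromBlocks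
      (Matrix.of fun l l' : Fin m => F (Sum.inr (βr l)) (Sum.inr (βc l')))
      (Matrix.of fun l k => (if Q (Sum.inr k) then (1 : ℂ) else 0) * F (Sum.inr (βr l)) (Sum.inr k))
      0 (F.submatrix Sum.inr Sum.inr) := by
    ext i j
    rcases i with l | k <;> rcases j with l' | k'
    · rw [hNH_inl, Matrix.fromBlocks_apply₁₁]
      simp only [multiEdgeAux, Matrix.of_apply, hQ l', hQ0 l', if_true, if_false, hcol, one_mul,
        zero_mul, sub_zero]
    · rw [hNH_inr, Matrix.fromBlocks_apply₁₂]
      simp only [multiEdgeAux, Matrix.of_apply]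
    · rw [hNH_inl, Matrix.fromBlocks_apply₂₁, Matrix.zero_apply]
      simp only [multiEdgeAux, Matrix.of_apply, hQ l', hQ0 l', and_true, and_false, if_false, hcol,
        one_mul]
      split_ifs <;> ring
    · rw [hNH_inr, Matrix.fromBlocks_apply₂₂, Matrix.submatrix_apply]
      simp only [multiEdgeAux, Matrix.of_apply]
      split_ifs <;> ring
  have h1 := congrArg Matrix.det key
  rw [Matrix.det_mul, hHdet, mul_one, Matrix.det_fromBlocks_zero₂₁] at h1
  exact h1

/-- **The `m`-edge determinant step.**  Under the hypotheses of the module docstring some `t : ℂ`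
makes the masked matrix `M(t)` nonsingular. -/
theorem exists_det_multiEdge_ne_zero (F : Matrix (Fin m ⊕ ρ) (Fin m ⊕ ρ) ℂ) (P Q : Fin m ⊕ ρ → Prop)
    [DecidablePred P] [DecidablePred Q] (βr βc : Fin m → ρ)
    (hP : ∀ l, P (Sum.inl l)) (hP0 : ∀ l, ¬ P (Sum.inr (βr l)))
    (hQ : ∀ l, Q (Sum.inl l)) (hQ0 : ∀ l, ¬ Q (Sum.inr (βc l)))
    (hrow : ∀ l j, F (Sum.inl l) j = F (Sum.inr (βr l)) j)
    (hcol : ∀ i l, F i (Sum.inl l) = F i (Sum.inr (βc l)))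
    (hbase : (Matrix.of fun l l' : Fin m => F (Sum.inr (βr l)) (Sum.inr (βc l'))).det ≠ 0)
    (hred : (F.submatrix Sum.inr Sum.inr).det ≠ 0) :
    ∃ t : ℂ, (multiEdgeMatrix F P Q t).det ≠ 0 := by
  classical
  -- D(t) = det N(t) is continuous and D(1) ≠ 0
  set D : ℂ → ℂ := fun t => (multiEdgeAux F P Q βr t).det with hD
  have hD1 : D 1 ≠ 0 := by
    rw [hD]
    show (multiEdgeAux F P Q βr 1).det ≠ 0
    rw [det_multiEdgeAux_one F P Q βr βc hQ hQ0 hcol]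
    exact mul_ne_zero hbase hred
  have hcont : Continuous D := by
    refine Continuous.matrix_det ?_
    refine continuous_pi fun i => continuous_pi fun j => ?_
    rcases i with l | k
    · simp only [multiEdgeAux, Matrix.of_apply]
      exact continuous_const
    · simp only [multiEdgeAux, Matrix.of_apply]
      split_ifs
      · exact continuous_id.mul continuous_const
      · exact continuous_const
  -- the open set {D ≠ 0} contains 1, hence a point t ≠ 1
  have hopen : IsOpen {t : ℂ | D t ≠ 0} := isOpen_ne_fun hcont continuous_const
  obtain ⟨ε, hε, hball⟩ := Metric.isOpen_iff.mp hopen 1 hD1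
  refine ⟨1 + ε / 2, ?_⟩
  have hmem : (1 + (ε / 2 : ℂ)) ∈ Metric.ball (1 : ℂ) ε := by
    rw [Metric.mem_ball, dist_eq_norm]
    have : (1 + (ε / 2 : ℂ)) - 1 = ((ε / 2 : ℝ) : ℂ) := by push_cast; ring
    rw [this, Complex.norm_real, Real.norm_eq_abs, abs_of_pos (by positivity)]
    linarith
  have hDt : D (1 + ε / 2) ≠ 0 := hball hmem
  have hne : (1 + (ε / 2 : ℂ)) - 1 ≠ 0 := by
    have : (1 + (ε / 2 : ℂ)) - 1 = ((ε / 2 : ℝ) : ℂ) := by push_cast; ring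
    rw [this, Complex.ofReal_ne_zero]
    positivity
  rw [det_multiEdgeMatrix_eq F P Q βr hP hP0 hrow]
  exact mul_ne_zero (pow_ne_zero _ hne) hDt

end

end Summit.ValiantsHypothesis.ValiantsHypothesis.Theorems.BarrierLever.ChowFactor
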